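import Summits.ABC.IUTFork.LDHSlotRegimePointTransport
import HarnessLib

/-!
# The fork at [IUTchIII] Corollary 3.12, L-DH level, READING (U): the point-slot-constant locus CONTAINS the `d_mod = 1` cut, and
# v4's regime antecedent puts a MIXED prime on the point (abc-iut cell, R2 S-chain team seat abc-iut-s2-p1; crux ThetaPartII =
# stmt-ABC-19678; consistency corollaries of `LDHSlotRegimePointTransport`)

Record-only PROOF file (D-0012) of the abc-iut cell; TAKES NO SIDE on [IUTchIII] Cor. 3.12 or on the (U)/(P) readings of "−|log(Θ)|".
Mochizuki, *Inter-universal Teichmüller theory IV* (RIMS manuscript Apr. 2020 = PRIMS **57** (2021)), Thm. 1.10 proof Steps (ii)–(v)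
pp. 24–29; Dupuy–Hilado [DupuyHilado2025] §3.6 (`Σ_{u|p} n_u = [F_mod:ℚ]`).

* `PointDict.pointSlotConstant_of_dmod_eq_one` — at `d_mod = [ℚ(j(λ)):ℚ] = 1` there is ONE place of `ℚ(j(λ))` over each prime
  (abc-iut-s2-p5's count in `splitPair_vacuous_of_dmod_eq_one`), so `h♭` is constant over every `p`: the hypothesis of
  `hullVolumeAtDatum_BIII_of_pointSlotConstant` holds — the datum-free locus CONTAINS the `d = 1` cut;
* `PointDict.hullVolumeAtDatum_BIII_of_dmod_eq_one_point` — hence abc-iut-S3's `d_mod = 1` theorem is RECOVERED from the point-locus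
  theorem (consistency; the (R4) input is discharged inside by abc-iut-S1's `R4_towerFact`);
* `PointDict.exists_pointMixed_of_not_slotConstant` — v4's `hreg` regime antecedent at a datum (`¬ ∀ p ∈ T(I), ∀ v w | p,
  logQloc p v = logQloc p w`) puts a MIXED prime on the POINT: some support prime `p` over which `h♭` is not constant on the places
  of `ℚ(j(λ))` — the datum-free reading of the regime clause.
HONEST SCOPE: corollaries of the transport; no datum constructed; no side taken; typed ≠ proved. PROOF-ONLY file: no definitions.
[cite: Mochizuki2012, IUTchIV Thm. 1.10 proof Steps (ii)–(v) p. 24–29] [cite: DupuyHilado2025, §3.6]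
[claim: Mochizuki2012, status: disputed] for every IUT quotation.
-/

noncomputable section

namespace Summit.ABC.IUTFork

open NumberField IsDedekindDomain Literature.IUT.LogVolume Literature.IUT.HodgeTheaters
open Literature.NumberTheory.DiophantineGeometry.GenEll
open scoped Classical

namespace PointDict

variable {P : NFPoint} {l : ℕ}

/-- **At `d_mod = 1` the point is slot-constant at every prime**: `[ℚ(j(λ)):ℚ] = 1` forces ONE place of `ℚ(j(λ))` over each
rational prime (`Σ_{u|p} n_u = [ℚ(j(λ)):ℚ]`, every `n_u ≥ 1`), so `h♭` takes one value over `p`. [cite: DupuyHilado2025, §3.6] -/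
theorem pointSlotConstant_of_dmod_eq_one (hd : Cor22.dmod P = 1) (p : ℕ) (hp : p.Prime)
    (V W : HeightOneSpectrum (𝓞 ↥(IntermediateField.adjoin ℚ ({Cor22.jInv P.x} : Set P.F))))
    (hV : V ∈ placesOver _ p) (hW : W ∈ placesOver _ p) :
    (if ord _ V (Cor22.jMod P) < 0 ∧ ((2 : ℕ) : 𝓞 _) ∉ V.asIdeal ∧ ((l : ℕ) : 𝓞 _) ∉ V.asIdeal
      then ((-ord _ V (Cor22.jMod P) : ℤ) : ℝ) * logNorm _ V / (localDegree _ V : ℝ) else 0) =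
    (if ord _ W (Cor22.jMod P) < 0 ∧ ((2 : ℕ) : 𝓞 _) ∉ W.asIdeal ∧ ((l : ℕ) : 𝓞 _) ∉ W.asIdeal
      then ((-ord _ W (Cor22.jMod P) : ℤ) : ℝ) * logNorm _ W / (localDegree _ W : ℝ) else 0) := by
  haveI : Fact p.Prime := ⟨hp⟩
  set Fm : Type := ↥(IntermediateField.adjoin ℚ ({Cor22.jInv P.x} : Set P.F)) with hFm
  have hsum : ∑ u ∈ placesOver Fm p, localDegree Fm u = 1 := by rw [sum_localDegree Fm p]; exact hd
  have hcard : (placesOver Fm p).card ≤ 1 := by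
    have h1 : (placesOver Fm p).card • 1 ≤ ∑ u ∈ placesOver Fm p, localDegree Fm u :=
      Finset.card_nsmul_le_sum _ _ 1 fun u _ => localDegree_pos Fm u
    rw [hsum, smul_eq_mul, mul_one] at h1
    exact h1
  have hVW : V = W := Finset.card_le_one.mp hcard V hV W hW
  subst hVW
  rfl

/-- **The `d_mod = 1` cut RECOVERED from the point-slot-constant theorem** (consistency with abc-iut-S3's
`hullVolumeAtDatum_BIII_pinned_of_dmod_eq_one`; here the (R4) input is discharged inside): for `λ ∈ U_P` minimal, `l ≥ 7`,
`[ℚ(j(λ)):ℚ] = 1` ⟹ `Cor22.HullVolumeAtDatum P l (B_III P l)`. [cite: Mochizuki2012, IUTchIV Thm. 1.10 proof Steps (ii)–(v) p. 24–29]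
[claim: Mochizuki2012, status: disputed] -/
theorem hullVolumeAtDatum_BIII_of_dmod_eq_one_point (hP : P ∈ UP) (h7 : 7 ≤ l) (hd : Cor22.dmod P = 1) :
    Cor22.HullVolumeAtDatum P l (((l : ℝ) + 1) / 4 * ((1 + 12 * (Cor22.dmod P : ℝ) / l)
      * (P.logDiff + Cor22.logCondAvoid P {2, l}) + 2 * Real.log l + 52
        + 20 / 3 * Real.log (((2 ^ 12 * 3 ^ 3 * 5 * Cor22.dmod P : ℕ) : ℝ) * (l : ℝ))
          * (Nat.primeCounting (2 ^ 12 * 3 ^ 3 * 5 * Cor22.dmod P * l) : ℝ))) :=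
  hullVolumeAtDatum_BIII_of_pointSlotConstant hP h7 (fun p hp V W hV hW => pointSlotConstant_of_dmod_eq_one hd p hp V W hV hW)

/-- **v4's regime antecedent READ ON THE POINT**: if a genuine Θ-volume datum `T` at `(P, l)` is NOT slot-constant (the antecedent of
`abc_of_S_v4`'s `hreg` / c312-8's `stub_hullRegime`: `¬ ∀ p ∈ T(I), ∀ v w | p, logQloc p v = logQloc p w`), then there is a support
prime `p` of `T` over which `h♭` is NOT constant on the places of `ℚ(j(λ))` — `λ` has a MIXED prime (a bad prime `∤ 2l` under two
places of `ℚ(j(λ))` of different normalised `q`-order, or under a bad and a non-bad place). [cite: Mochizuki2012, IUTchIV Thm. 1.10 Step (v) p. 27–28]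
[cite: DupuyHilado2025, §3.3, §3.6] [claim: Mochizuki2012, status: disputed] -/
theorem exists_pointMixed_of_not_slotConstant (T : Cor22.ThetaVolumeDatumAt P l)
    (h : letI := T.instFieldF; letI := T.instNumberFieldF; letI := T.instAlgebraF; letI := T.instFieldK
      letI := T.instNumberFieldK; letI := T.instAlgebraK; letI := T.instFieldFbar; letI := T.instAlgebraFbar
      letI := T.instAlgebraKFbar; letI := T.instIsElliptic
      ¬ (∀ p ∈ T.I.supportPrimes, ∀ v w : placesOver ↥(fieldOfModuli T.E) p,
        (DHData.ofInput T.I).logQloc p v = (DHData.ofInput T.I).logQloc p w)) :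
    ∃ p : ℕ, p.Prime ∧
      (letI := T.instFieldF; letI := T.instNumberFieldF; letI := T.instFieldK; letI := T.instNumberFieldK
       letI := T.instAlgebraK
       p ∈ T.I.supportPrimes) ∧
      ¬ ∀ V W : HeightOneSpectrum (𝓞 ↥(IntermediateField.adjoin ℚ ({Cor22.jInv P.x} : Set P.F))),
        V ∈ placesOver _ p → W ∈ placesOver _ p →
        (if ord _ V (Cor22.jMod P) < 0 ∧ ((2 : ℕ) : 𝓞 _) ∉ V.asIdeal ∧ ((l : ℕ) : 𝓞 _) ∉ V.asIdeal
          then ((-ord _ V (Cor22.jMod P) : ℤ) : ℝ) * logNorm _ V / (localDegree _ V : ℝ) else 0) =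
        (if ord _ W (Cor22.jMod P) < 0 ∧ ((2 : ℕ) : 𝓞 _) ∉ W.asIdeal ∧ ((l : ℕ) : 𝓞 _) ∉ W.asIdeal
          then ((-ord _ W (Cor22.jMod P) : ℤ) : ℝ) * logNorm _ W / (localDegree _ W : ℝ) else 0) := by
  letI := T.instFieldF; letI := T.instNumberFieldF; letI := T.instAlgebraF; letI := T.instFieldK
  letI := T.instNumberFieldK; letI := T.instAlgebraK; letI := T.instFieldFbar; letI := T.instAlgebraFbar
  letI := T.instAlgebraKFbar; letI := T.instIsElliptic
  push Not at h
  obtain ⟨p, hp, v, w, hvw⟩ := h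
  haveI : Fact p.Prime := ⟨T.I.prime_of_mem_supportPrimes hp⟩
  refine ⟨p, T.I.prime_of_mem_supportPrimes hp, hp, ?_⟩
  exact not_pointConstant_of_not_slotConstant T p (fun hall => hvw (hall v w))

/-- **The `d_mod = 1` slice of v4's regime clause is EMPTY, read on the point**: at `[ℚ(j(λ)):ℚ] = 1` every genuine datum at
`(P, l)` IS slot-constant (so `hreg` demands nothing there) — c312-8's `hullRegime_vacuous_of_dmod_eq_one` recovered through the
point. [cite: DupuyHilado2025, §3.6] [claim: Mochizuki2012, status: disputed] -/
theorem slotConstant_of_dmod_eq_one_point (T : Cor22.ThetaVolumeDatumAt P l) (hd : Cor22.dmod P = 1) :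
    (letI := T.instFieldF; letI := T.instNumberFieldF; letI := T.instAlgebraF; letI := T.instFieldK
     letI := T.instNumberFieldK; letI := T.instAlgebraK; letI := T.instFieldFbar; letI := T.instAlgebraFbar
     letI := T.instAlgebraKFbar; letI := T.instIsElliptic
     ∀ p ∈ T.I.supportPrimes, ∀ v w : placesOver ↥(fieldOfModuli T.E) p,
       (DHData.ofInput T.I).logQloc p v = (DHData.ofInput T.I).logQloc p w) := by
  letI := T.instFieldF; letI := T.instNumberFieldF; letI := T.instAlgebraF; letI := T.instFieldK
  letI := T.instNumberFieldK; letI := T.instAlgebraK; letI := T.instFieldFbar; letI := T.instAlgebraFbar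
  letI := T.instAlgebraKFbar; letI := T.instIsElliptic
  intro p hp v w
  haveI : Fact p.Prime := ⟨T.I.prime_of_mem_supportPrimes hp⟩
  exact slotConstant_of_point T p
    (fun V W hV hW => pointSlotConstant_of_dmod_eq_one hd p (T.I.prime_of_mem_supportPrimes hp) V W hV hW) v w

end PointDict

end Summit.ABC.IUTFork

end
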